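import Mathlib
import Literature.Probability.Percolation.InterfaceScalingLimit
import Literature.Probability.LatticeModels.DobrushinDiscretisation
import HarnessLib.Audit
import Literature.Probability.Percolation.InterfaceScalingLimitDiscretised
import HarnessLib

/-!
# SLE6LimitZ2AllDiscretisations — CONJECTURE (obligation of CriticalPhenomena/CardyFormulaZ2)

Unproven conjecture migrated by the gate from `Literature/Probability/Percolation/InterfaceScalingLimitDiscretised.lean` (`Literature.Probability.Percolation.SLE6LimitZ2AllDiscretisations`): unproven conjectures are obligations of our
theories, not literature facts (human ruling 2026-08-15). Provenance: Smirnov2007ICM. Routes use it as a crux item or via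
`--conditional-bridge --conditional-on SLE6LimitZ2AllDiscretisations`; a proof goes in the sibling `Theorems/SLE6LimitZ2AllDiscretisationsHolds.lean` as `theorem SLE6LimitZ2AllDiscretisations_holds : SLE6LimitZ2AllDiscretisations` so this file stays a conjecture LEAF that Literature/ may import.
-/

namespace Summit.CriticalPhenomena.CardyFormulaZ2

open Literature Literature.Probability Literature.Probability.Percolation
open MeasureTheory Filter Topology
open scoped unitInterval
open LatticeModels

/-- OPEN CONJECTURE — **crit-perc.S02, corrected form: conformal invariance of critical bond
percolation on `ℤ²`, interface version, for arbitrary admissible discretisations** (posed in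
Smirnov, ICM 2006, §2.3, Conjecture 4 at `q = 1`; [status: open] — stated as a `Prop`-valued
definition, CONVENTIONS §4; no refereed proof as of the status check of 2026-08-15 in the module
docstring, §1, which also records the unrefereed claim arXiv:2409.03235 and why it would not
discharge this def as stated). Smirnov, *Towards conformal invariance of 2D lattice models*
(ICM 2006), §2.1 and Conjecture 4 at `q = 1` (`κ = 4π / arccos (-1/2) = 6`); Werner (2007)
proves the triangular-site analogue (Thm 3.1) and notes that the square-lattice case is not
proved (p. 4). For every Jordan domain with two marked boundary points `(Ω; a, b) = D` and
every family `(Ω_δ; a_δ, b_δ) = E δ` of admissible square-lattice Dobrushin discretisations of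
it (`ZdDiscretisationFamily D E`, `DobrushinDiscretisation.lean` — the model-independent copy of
`IsDiscretisation D E` of `InterfaceSLE.lean`, same fields: vertex set `Ω_δ = meshDomain Ω δ`,
mesh `δ`, the wired arc of the
data converging to `(ab)` and the dual-wired arc to `(ba)` in Hausdorff distance, the discrete
marked points converging to `{a, b}`, and `IsZdAdmissible` for all small `δ > 0`), consider
critical bond percolation `P_{1/2}` on `δℤ²` with the edges of `Ω_δ` along the wired arc open
and the edges at the dual-wired arc closed (G02's `bcBondConfig`). Then the medial exploration
interface from `a_δ` to `b_δ` (`bondInterfaceIn D (E δ)`) converges in law as `δ → 0⁺`, in the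
space `CurveClass ℂ` of curves modulo reparametrisation (sup–inf metric, Smirnov §2.1), to
chordal SLE₆ in `(Ω; a, b)` (`ConvergesInLawToSLE 6 D`: to a random curve `Γ` with
`IsSLECurve 6 D Γ`).

**Discrepancy with `SLE6LimitZ2` (same sources).** The tree's `SLE6LimitZ2` is this statement
restricted to the single family `E = dobrushinData D` under the guard
`∀ᶠ δ in 𝓝[>] 0, (dobrushinData D δ).IsZdAdmissible`; that guard fails at every mesh for
`DobrushinDomain.unitDisc` (`not_isZdAdmissible_dobrushinData_unitDisc`,
`sle6LimitZ2_unitDisc_vacuous` in `CanonicalDiscretisationTies.lean`) and — by a hand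
computation recorded in the module docstring, not formalised — along a sequence of meshes
`δ_k → 0⁺` for every axis-aligned rectangle with any two marked points (tie sites of
`zdDiscreteArc`), so `SLE6LimitZ2` is silent about the domains the conjecture is usually stated
for, whereas the sources let the lattice approximation be chosen. The present form follows the reviewed
rendering of crit-ising.S17 (`convergesInLawToSLE_sixteen_thirds_fkInterface`). It implies the
conclusion of `SLE6LimitZ2` wherever the canonical data form a `ZdDiscretisationFamily`
(`convergesInLawToSLE_bondInterface_of_allDiscretisations`).

**Registered OPEN statement, not literature debt.** Status re-verified on 2026-08-15 (two
defact-verdict passes; review of p56189) with the source open: arXiv:0708.0032 states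
Conjecture 4 in §2.3 for all `q ∈ [0, 4]`, and the next page lists `q = 1`, "equivalent to the
critical bond percolation on the square lattice", among the values where the method "does not
yet work all the way"; Werner 2009 (p. 4, p. 49) and Duminil-Copin–Kozlowski–Krachun–Manolescu–
Oulamara 2020 (§1.1) confirm the status (module docstring, §1, which also records — for status
only, D-0012, not vendored — the unrefereed claim arXiv:2409.03235 and the contrary unrefereed
claims arXiv:2206.04599v2, arXiv:2309.05121); a zbMATH/arXiv sweep of 2022–2026 (2026-08-15)
finds no refereed proof or disproof. Hence there is no `SLE6LimitZ2AllDiscretisations_holds` and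
none is expected short of solving the problem: the `Prop` is used only as an explicit hypothesis
`(h : SLE6LimitZ2AllDiscretisations)` — by the two reductions below, by
`sle6LimitZ2AllDiscretisations_iff_interface` (`InterfaceCurvesBridge.lean`), and by the
`CardyFormulaZ2` theses, which inline its body verbatim as their SLE₆ crux. The name is kept (not
renamed `…Conjecture`) because of those by-name users; the Lean statement is unchanged since the
reviewed rendering.
[cite: Smirnov2007ICM, §2.3 Conjecture 4 (q = 1; posed there, not proved)] [status: open] -/
@[conjecture] def SLE6LimitZ2AllDiscretisations : Prop :=
  ∀ (D : RandomPlanarGeometry.DobrushinDomain) (E : ℝ → DiscreteDobrushin)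
    (_hE : ZdDiscretisationFamily D E),
    RandomPlanarGeometry.ConvergesInLawToSLE 6 D (Ωδ := fun _ ↦ BondConfig (Site 2))
      (fun δ ↦ bondInterfaceIn D (E δ)) fun _ ↦ bondPercolation (zdGraph 2) half

/-! ### Relation with the canonical discretisation -/

end Summit.CriticalPhenomena.CardyFormulaZ2
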